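import Mathlib
import Summits.Ventures.PercRepro2.Defs
import Summits.Ventures.PercRepro2.Harris
import Summits.Ventures.PercRepro2.CoinDefs
import Summits.Ventures.PercRepro2.CoinInduced
import Summits.Ventures.PercRepro2.CoinFrontier
import Summits.Ventures.PercRepro2.CoinVdBK
import Summits.Ventures.PercRepro2.CoinBHK

/-!
# The reversed coin system and the T-frame (blind cell PercRepro2, night-2)

`revArcs arcs` reverses every arc; reachability reverses with it (`reach_revArcs`), `SameEnds` is
preserved, and the backward cluster of a single target `t` is the forward cluster of `t` in the
reversed system (`bwdEvent_singleton_eq`).  Hence the directed van den Berg–Kahn inequality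
`vdBKC` of `CoinVdBK.lean` holds in the T-FRAME for a single target: with `Q⁻_A = {a ⇝ t ∀ a ∈ A}`
(`A ⊆ K⁻`) and `R⁻_X = {x ↛ t ∀ x ∈ X}` (`K⁻` avoids `X`),
`P(Q⁻_A ∩ R⁻_X) · P(Q⁻_B ∩ R⁻_Y) ≤ P(Q⁻_{A∪B} ∩ R⁻_{X∩Y}) · P(R⁻_{X∪Y})` (`vdBKC_rev`) — directed
BHK 1.3 for the backward cluster `K⁻` given that it avoids `s` (the BASE row «in both frames»,
CHECKPOINT §1; MINEC-GATE.md §8 (b)), the ingredient of the Lemma A′ side of the one-arc gate.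
`trace_bhk` is the functional form for the TRACE `K⁻ ∩ P` of the backward cluster on a vertex set
`P` given that `K⁻` avoids `{s} ∪ U`: the positive-association input (AV-PA) of the branching
pendant theorem (NIGHT2-DARC.md §15.2).
-/

namespace Summit.Ventures.PercRepro2.Coin

section Reverse

variable {V : Type*} {E : Type*} [DecidableEq V]

/-- The reversed coin system: every arc `(x, y)` becomes `(y, x)`. -/
def revArcs (arcs : E → Finset (V × V)) : E → Finset (V × V) :=
  fun e => (arcs e).image Prod.swap

/-- An arc of the reversed system is a reversed arc. -/
lemma mem_revArcs {arcs : E → Finset (V × V)} {e : E} {x y : V} :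
    (x, y) ∈ revArcs arcs e ↔ (y, x) ∈ arcs e := by
  unfold revArcs
  constructor
  · intro h
    obtain ⟨⟨u, v⟩, huv, hsw⟩ := Finset.mem_image.1 h
    simp only [Prod.swap_prod_mk, Prod.mk.injEq] at hsw
    obtain ⟨rfl, rfl⟩ := hsw
    exact huv
  · intro h
    exact Finset.mem_image.2 ⟨(y, x), h, rfl⟩

/-- Open arcs reverse. -/
lemma openArc_revArcs {arcs : E → Finset (V × V)} {ω : Config E} {x y : V} :
    OpenArc (revArcs arcs) ω x y ↔ OpenArc arcs ω y x := by
  unfold OpenArc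
  simp only [mem_revArcs]

/-- Reachability reverses: `x ⇝ y` in the reversed system iff `y ⇝ x` in the original. -/
lemma reach_revArcs {arcs : E → Finset (V × V)} {ω : Config E} {x y : V} :
    Reach (revArcs arcs) ω x y ↔ Reach arcs ω y x := by
  unfold Reach
  have h : OpenArc (revArcs arcs) ω = Function.swap (OpenArc arcs ω) := by
    funext u v
    exact propext openArc_revArcs
  rw [h]
  exact Relation.reflTransGen_swap

/-- `SameEnds` is preserved by reversal. -/
lemma sameEnds_revArcs {arcs : E → Finset (V × V)} (hS : SameEnds arcs) :
    SameEnds (revArcs arcs) := by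
  intro e xy hxy x'y' hx'y'
  obtain ⟨x, y⟩ := xy
  obtain ⟨x', y'⟩ := x'y'
  rw [mem_revArcs] at hxy hx'y'
  have h := hS e (y, x) hxy (y', x') hx'y'
  exact ⟨h.2.symm, h.1.symm⟩

/-- The backward cluster of a single target is the forward cluster of `t` in the reversed system:
`{v ∈ K⁻} = {t ⇝ v in revArcs}`. -/
lemma bwdEvent_singleton_eq (arcs : E → Finset (V × V)) (v t : V) :
    bwdEvent arcs v {t} = fwdEvent (revArcs arcs) t v := by
  ext ω
  simp only [bwdEvent, fwdEvent, Set.mem_setOf_eq, Finset.mem_singleton, exists_eq_left,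
    reach_revArcs]

/-- `{K⁻ avoids X}` (single target `t`) is the avoidance event of `t` in the reversed system. -/
lemma bwdAvoid_eq (arcs : E → Finset (V × V)) (t : V) (X : Finset V) :
    {ω | ∀ x ∈ X, ¬ Reach arcs ω x t} = avoidEvent (revArcs arcs) t X := by
  ext ω
  simp only [avoidEvent, Set.mem_setOf_eq, reach_revArcs]

end Reverse

section TFrame

variable {V : Type*} {E : Type*} [Fintype E] [DecidableEq E] [Fintype V] [DecidableEq V]
  {R : Type*} [CommRing R] [LinearOrder R] [IsStrictOrderedRing R]

/-- **Directed van den Berg–Kahn in the T-frame** (single target `t`, `SameEnds`): with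
`Q⁻_A = {a ⇝ t ∀ a ∈ A}` and `R⁻_X = {x ↛ t ∀ x ∈ X}`,
`P(Q⁻_A ∩ R⁻_X) · P(Q⁻_B ∩ R⁻_Y) ≤ P(Q⁻_{A∪B} ∩ R⁻_{X∩Y}) · P(R⁻_{X∪Y})`. -/
theorem vdBKC_rev (p : E → R) (hp : IsProbVec p) {arcs : E → Finset (V × V)}
    (hS : SameEnds arcs) (t : V) (A B X Y : Finset V) :
    prob p ({ω | ∀ a ∈ A, Reach arcs ω a t} ∩ {ω | ∀ x ∈ X, ¬ Reach arcs ω x t}) *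
        prob p ({ω | ∀ a ∈ B, Reach arcs ω a t} ∩ {ω | ∀ x ∈ Y, ¬ Reach arcs ω x t}) ≤
      prob p ({ω | ∀ a ∈ A ∪ B, Reach arcs ω a t} ∩ {ω | ∀ x ∈ X ∩ Y, ¬ Reach arcs ω x t}) *
        prob p {ω | ∀ x ∈ X ∪ Y, ¬ Reach arcs ω x t} := by
  have h := vdBKC p hp (sameEnds_revArcs hS) t A B X Y
  have e : ∀ C : Finset V, connAllC (revArcs arcs) t C = {ω | ∀ a ∈ C, Reach arcs ω a t} := by
    intro C; ext ω; simp only [connAllC, Set.mem_setOf_eq, reach_revArcs]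
  simp only [e, ← bwdAvoid_eq] at h
  exact h

/-- **Directed BHK 1.3 in the T-frame** (cleared form): for a single target `t` and a root `s`,
the events `{a ∈ K⁻}`, `{b ∈ K⁻}` are positively correlated given `{s ∉ K⁻}`:
`P(a ∈ K⁻, s ∉ K⁻) · P(b ∈ K⁻, s ∉ K⁻) ≤ P(a, b ∈ K⁻, s ∉ K⁻) · P(s ∉ K⁻)`. -/
theorem bwd_bhk_pair (p : E → R) (hp : IsProbVec p) {arcs : E → Finset (V × V)}
    (hS : SameEnds arcs) (s t a b : V) :
    prob p (bwdEvent arcs a {t} ∩ (bwdEvent arcs s {t})ᶜ) *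
        prob p (bwdEvent arcs b {t} ∩ (bwdEvent arcs s {t})ᶜ) ≤
      prob p (bwdEvent arcs a {t} ∩ bwdEvent arcs b {t} ∩ (bwdEvent arcs s {t})ᶜ) *
        prob p (bwdEvent arcs s {t})ᶜ := by
  have h := vdBKC_rev p hp hS t {a} {b} {s} {s}
  have e1 : ∀ c : V, {ω : Config E | ∀ a ∈ ({c} : Finset V), Reach arcs ω a t} =
      bwdEvent arcs c {t} := by
    intro c; ext ω; simp [bwdEvent]
  have e2 : {ω : Config E | ∀ x ∈ ({s} : Finset V), ¬ Reach arcs ω x t} =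
      (bwdEvent arcs s {t})ᶜ := by
    ext ω; simp [bwdEvent]
  have e3 : {ω : Config E | ∀ c ∈ ({a} ∪ {b} : Finset V), Reach arcs ω c t} =
      bwdEvent arcs a {t} ∩ bwdEvent arcs b {t} := by
    ext ω; simp [bwdEvent]
  simp only [Finset.inter_self, Finset.union_self, e1, e2, e3] at h
  exact h

omit [Fintype E] [DecidableEq E] [Fintype V] in
/-- The backward cluster of `t` as a set: `{v | v ⇝ t}` is the forward cluster of `t` in the reversed
system. -/
lemma clusterC_revArcs (arcs : E → Finset (V × V)) (ω : Config E) (t : V) :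
    clusterC (revArcs arcs) ω t = {v | Reach arcs ω v t} := by
  ext v; simp only [clusterC, Set.mem_setOf_eq, reach_revArcs]

/-- **(AV-PA): positive association of the trace `K⁻ ∩ P` of the backward cluster on every
avoidance event** (functional form, single target `t`, `SameEnds`): for nonnegative monotone
`f₁, f₂ : Set V → R` and any `U`, with `R = {K⁻ avoids {s} ∪ U}`,
`E[f₁(K⁻ ∩ P) 1_R] · E[f₂(K⁻ ∩ P) 1_R] ≤ E[(f₁f₂)(K⁻ ∩ P) 1_R] · P(R)` —
directed BHK 1.3 for the backward cluster, the input of the branching pendant theorem. -/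
theorem trace_bhk (p : E → R) (hp : IsProbVec p) {arcs : E → Finset (V × V)} (hS : SameEnds arcs)
    (t s : V) (U : Finset V) (P : Set V) {f₁ f₂ : Set V → R} (hf₁ : Monotone f₁)
    (hf₂ : Monotone f₂) (hf₁0 : ∀ S, 0 ≤ f₁ S) (hf₂0 : ∀ S, 0 ≤ f₂ S) :
    expect p ((fun ω => f₁ ({v | Reach arcs ω v t} ∩ P)) *
          ({ω | ∀ x ∈ insert s U, ¬ Reach arcs ω x t} : Set (Config E)).indicator 1) *
        expect p ((fun ω => f₂ ({v | Reach arcs ω v t} ∩ P)) *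
          ({ω | ∀ x ∈ insert s U, ¬ Reach arcs ω x t} : Set (Config E)).indicator 1) ≤
      expect p ((fun ω => f₁ ({v | Reach arcs ω v t} ∩ P) * f₂ ({v | Reach arcs ω v t} ∩ P)) *
          ({ω | ∀ x ∈ insert s U, ¬ Reach arcs ω x t} : Set (Config E)).indicator 1) *
        prob p {ω | ∀ x ∈ insert s U, ¬ Reach arcs ω x t} := by
  have hF₁ : Monotone (fun K : Set V => f₁ (K ∩ P)) :=
    fun _ _ h => hf₁ (Set.inter_subset_inter_left P h)
  have hF₂ : Monotone (fun K : Set V => f₂ (K ∩ P)) :=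
    fun _ _ h => hf₂ (Set.inter_subset_inter_left P h)
  have h := bhkC p hp (sameEnds_revArcs hS) t hF₁ hF₂ (fun S => hf₁0 _) (fun S => hf₂0 _)
    (insert s U) (insert s U)
  simp only [Finset.inter_self, Finset.union_self, clusterC_revArcs, ← bwdAvoid_eq, Pi.mul_apply] at h
  exact h

end TFrame

end Summit.Ventures.PercRepro2.Coin
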